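import Literature.MathematicalPhysics.KineticTheory.DiPernaLionsSchemeHolds
import Literature.MathematicalPhysics.KineticTheory.DiPernaLionsTruncatedProblemProofs
import HarnessLib

/-!
# The DiPerna–Lions approximating scheme holds

Topic: MathematicalPhysics / KineticTheory. Discharge of the named fact
`Literature.MathematicalPhysics.KineticTheory.diPernaLions_approximatingScheme` of
`Literature/MathematicalPhysics/KineticTheory/DiPernaLionsStability` (the existence half (A) of
the DiPerna–Lions theorem: DiPerna–Lions, Ann. of Math. 130 (1989), Theorem p. 322, existence
part; printed proof Cercignani–Illner–Pulvirenti 1994 §5.3 Step 6, Lemma 5.3.6 (p. 145) and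
Step 7 (pp. 146–147) with Lemma 5.3.1 (3.4)–(3.9)). The proof is the tree's reduction
`diPernaLions_approximatingScheme_of_truncatedProblem` (`DiPernaLionsSchemeHolds`: conservation
laws and entropy identity of Lemma 5.3.1, the Step-7 kernel and data approximations, all proved)
applied to the discharge `truncatedProblem_globalExistence_holds` of CIP Lemma 5.3.6 (global
solvability of the truncated, normalised problems in the Schwartz class). Theorems only.

## References

* R. J. DiPerna, P.-L. Lions, *On the Cauchy problem for Boltzmann equations: global existence and
  weak stability*, Ann. of Math. 130 (1989) 321–366, Theorem p. 322.
* C. Cercignani, R. Illner, M. Pulvirenti, *The Mathematical Theory of Dilute Gases*, Springer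
  (1994), §5.3 Lemma 5.3.1 (p. 141), Step 6 and Lemma 5.3.6 (pp. 145–146), Step 7 (pp. 146–147).
-/

namespace Literature.MathematicalPhysics.KineticTheory

universe u

/-- **The DiPerna–Lions approximating scheme exists** (discharge of
`diPernaLions_approximatingScheme`): CIP 1994 §5.3 Steps 6–7 — Lemma 5.3.6
(`truncatedProblem_globalExistence_holds`) fed into the proved reduction
`diPernaLions_approximatingScheme_of_truncatedProblem`. [cite: DiPernaLionsAnnals1989, Theorem p. 322 (existence part)]
[cite: CIPDiluteGases1994, §5.3 Lemma 5.3.6 (p. 145) and Step 7 (pp. 146–147)] -/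
theorem diPernaLions_approximatingScheme_holds : diPernaLions_approximatingScheme.{u} :=
  diPernaLions_approximatingScheme_of_truncatedProblem truncatedProblem_globalExistence_holds

end Literature.MathematicalPhysics.KineticTheory
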